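import Literature.Computability.Complexity.FPRASTransfer
import Literature.Computability.Complexity.FPStringBricks

set_option linter.dupNamespace false

/-!
# Stub S3 `stub_coinSplit` of the line `SketchIdeator1` for crux stmt-PneNP-2717
`Summit.PneNP.PneNP.Theses.PhaseTwins.NoFBPPApproxAboveUniqueness`

The coin-splitting query transformer of the oracle-free Stockmeyer lever is in `FP`. On the canonical
counting query `⟨⟨x, ⟨1⁰, ⟨1^{kη}, 1^{kδ}⟩⟩⟩, U⟩ = countQuery x 0 kη kδ U` the transducer cuts the coins `U`
into the prefix `u = U ↾ ℓ₁`, `ℓ₁ = c₁(|x| + rp|x| + kη + k₀)` (Stockmeyer's coins at witness length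
`rp|x|` and fixed confidence `k₀`) and the next block `r = (U ↓ ℓ₁) ↾ T(|w|)` (simulation coins), rebuilds
Stockmeyer's query `w = countQuery x (rp|x|) kη k₀ u` and hands `⟨w, r⟩` to an inner map `H ∈ FP`.
Brick algebra only (`Brick.fstF/sndF`, `Plumb.polyFn/takeFn/dropFn`, `fanoutFn`, `append_mem_FP`,
`const_mem_FP`), exactly as in `Negative.hasFPRAS_of_padded` (`Negative/FPRASDictionary.lean`); no machine
is written and no definition is introduced.
-/

namespace Summit.PneNP.PneNP.Theorems.NoFBPPApproxAboveUniqueness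

open Literature.Computability.Complexity _root_.Computability Polynomial Brick Plumb

/-- **Stub S3.** For polynomials `rp` (witness length), `c₁` (inner coin budget), `T` (simulation coin
budget), a constant `k₀` (inner confidence) and an inner map `H ∈ FP`, the transducer
`⟨⟨x, ⟨1⁰, ⟨1^{kη}, 1^{kδ}⟩⟩⟩, U⟩ ↦ H ⟨w, r⟩` with `w = ⟨⟨x, ⟨1^{rp|x|}, ⟨1^{kη}, 1^{k₀}⟩⟩⟩, U ↾ ℓ₁⟩`,
`ℓ₁ = c₁(|x| + rp|x| + kη + k₀)`, `r = (U ↓ ℓ₁) ↾ T(|w|)` is in `FP` (brick algebra: `fstF/sndF`, `polyFn`,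
`takeFn`, `dropFn`, `fanoutFn`; no machine written). [folklore] -/
theorem stub_coinSplit (rp c₁ T : Polynomial ℕ) (k₀ : ℕ) {H : List Bool → List Bool} (hH : H ∈ FP) :
    ∃ F' ∈ FP, ∀ (x U : List Bool) (kη kδ : ℕ),
      F' (countQuery x 0 kη kδ U) =
        H (boolPair
            (countQuery x (rp.eval x.length) kη k₀
              (U.take (c₁.eval (x.length + rp.eval x.length + kη + k₀))))
            ((U.drop (c₁.eval (x.length + rp.eval x.length + kη + k₀))).take
              (T.eval (countQuery x (rp.eval x.length) kη k₀
                (U.take (c₁.eval (x.length + rp.eval x.length + kη + k₀)))).length))) := by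
  -- the pieces of the transformer: `x`, `1^{kη}`, `1^{rp|x|}`, `1^{k₀}`, the two rulers, the cut coins
  set xF : List Bool → List Bool := fstF ∘ fstF with hxF
  set etaF : List Bool → List Bool := fstF ∘ sndF ∘ sndF ∘ fstF with hetaF
  set mF : List Bool → List Bool := polyFn rp ∘ xF with hmF
  set k0F : List Bool → List Bool := fun _ => unaryEncodeNat k₀ with hk0F
  set sF : List Bool → List Bool := fun w => (xF w ++ mF w) ++ (etaF w ++ k0F w) with hsF
  set ruler₁ : List Bool → List Bool := polyFn c₁ ∘ sF with hruler₁
  set uF : List Bool → List Bool := takeFn ∘ fanoutFn ruler₁ sndF with huF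
  set restF : List Bool → List Bool := dropFn ∘ fanoutFn ruler₁ sndF with hrestF
  set wF : List Bool → List Bool :=
    fanoutFn (fanoutFn xF (fanoutFn mF (fanoutFn etaF k0F))) uF with hwF
  set ruler₂ : List Bool → List Bool := polyFn T ∘ wF with hruler₂
  set rF : List Bool → List Bool := takeFn ∘ fanoutFn ruler₂ restF with hrF
  set W : List Bool → List Bool := fanoutFn wF rF with hW
  -- `W ∈ FP`
  have hxFP : xF ∈ FP := comp_mem_FP fstF_mem_FP fstF_mem_FP
  have hetaFP : etaF ∈ FP :=
    comp_mem_FP fstF_mem_FP (comp_mem_FP sndF_mem_FP (comp_mem_FP sndF_mem_FP fstF_mem_FP))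
  have hmFP : mF ∈ FP := comp_mem_FP (polyFn_mem_FP rp) hxFP
  have hk0FP : k0F ∈ FP := const_mem_FP _
  have hsFP : sF ∈ FP := append_mem_FP (append_mem_FP hxFP hmFP) (append_mem_FP hetaFP hk0FP)
  have hruler₁FP : ruler₁ ∈ FP := comp_mem_FP (polyFn_mem_FP c₁) hsFP
  have huFP : uF ∈ FP := comp_mem_FP takeFn_mem_FP (fanoutFn_mem_FP hruler₁FP sndF_mem_FP)
  have hrestFP : restF ∈ FP := comp_mem_FP dropFn_mem_FP (fanoutFn_mem_FP hruler₁FP sndF_mem_FP)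
  have hwFP : wF ∈ FP :=
    fanoutFn_mem_FP (fanoutFn_mem_FP hxFP (fanoutFn_mem_FP hmFP (fanoutFn_mem_FP hetaFP hk0FP))) huFP
  have hruler₂FP : ruler₂ ∈ FP := comp_mem_FP (polyFn_mem_FP T) hwFP
  have hrFP : rF ∈ FP := comp_mem_FP takeFn_mem_FP (fanoutFn_mem_FP hruler₂FP hrestFP)
  have hWFP : W ∈ FP := fanoutFn_mem_FP hwFP hrFP
  refine ⟨H ∘ W, comp_mem_FP hH hWFP, fun x U kη kδ => ?_⟩
  -- semantics of `W` on the canonical query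
  have hx : xF (countQuery x 0 kη kδ U) = x := by
    simp [hxF, countQuery]
  have heta : etaF (countQuery x 0 kη kδ U) = unaryEncodeNat kη := by
    simp [hetaF, countQuery]
  have hm : mF (countQuery x 0 kη kδ U) = unaryEncodeNat (rp.eval x.length) := by
    simp [hmF, hx, APTransfer.ones_eq_unary]
  have hk0 : k0F (countQuery x 0 kη kδ U) = unaryEncodeNat k₀ := by
    simp [hk0F]
  have hs : (sF (countQuery x 0 kη kδ U)).length = x.length + rp.eval x.length + kη + k₀ := by
    simp [hsF, hx, hm, heta, hk0, APTransfer.length_unary]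
    omega
  have hsnd : sndF (countQuery x 0 kη kδ U) = U := by
    simp [countQuery]
  have hrul₁ : ruler₁ (countQuery x 0 kη kδ U) =
      ones (c₁.eval (x.length + rp.eval x.length + kη + k₀)) := by
    simp only [hruler₁, Function.comp_apply, polyFn_apply, hs]
  have hu : uF (countQuery x 0 kη kδ U) =
      U.take (c₁.eval (x.length + rp.eval x.length + kη + k₀)) := by
    simp only [huF, Function.comp_apply, fanoutFn_apply, hrul₁, hsnd, takeFn_boolPair,
      List.length_replicate]
  have hrest : restF (countQuery x 0 kη kδ U) =
      U.drop (c₁.eval (x.length + rp.eval x.length + kη + k₀)) := by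
    simp only [hrestF, Function.comp_apply, fanoutFn_apply, hrul₁, hsnd, dropFn_boolPair,
      List.length_replicate]
  have hw : wF (countQuery x 0 kη kδ U) =
      countQuery x (rp.eval x.length) kη k₀
        (U.take (c₁.eval (x.length + rp.eval x.length + kη + k₀))) := by
    simp only [hwF, fanoutFn_apply, hx, hm, heta, hk0, hu]
    rfl
  have hr : rF (countQuery x 0 kη kδ U) =
      (U.drop (c₁.eval (x.length + rp.eval x.length + kη + k₀))).take
        (T.eval (countQuery x (rp.eval x.length) kη k₀
          (U.take (c₁.eval (x.length + rp.eval x.length + kη + k₀)))).length) := by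
    simp only [hrF, hruler₂, Function.comp_apply, fanoutFn_apply, polyFn_apply, hw, hrest,
      takeFn_boolPair, List.length_replicate]
  simp only [Function.comp_apply, hW, fanoutFn_apply, hw, hr]

end Summit.PneNP.PneNP.Theorems.NoFBPPApproxAboveUniqueness
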